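import Summits.QuantumAdvantage.QuantumAdvantage.Theorems.CharDialSpreadRankB
import Summits.QuantumAdvantage.QuantumAdvantage.Theorems.CharDialRankOne

/-! # CharDialSpreadRank — part 3/3 (mechanical split for landing of `CharDialSpreadRank`; content verbatim; scopes re-opened with their variables) -/

noncomputable section
open Finset

namespace Summit.QuantumAdvantage.AdviceFreeQNC0.WindowCounter
open Summit.QuantumAdvantage.AdviceFreeQNC0

section FormLine
open AffBells22
variable (p : ℕ) {n : ℕ}
variable [Fact p.Prime]

/-- **ONE-FORM DIALS OF `log₂ n`-JUNTA TABLES LOSE IN EVERY DIRECTION** (every prime `p ≥ 5`; dense directions by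
`formJunta_small` + `form_reduction`, sparse ones by `form_sparse_junta_hard`). -/
theorem formDialAny_hard (hp : 5 ≤ p) {θ₀ : ℝ} (hθ₀ : θ₀ < 1)
    (h1 : ∃ n₀ : ℕ, ∀ n ≥ n₀, ∀ (c : ℕ) (y : Fin (n + 1) → (Fin n → Bool) → Bool),
      (∀ g, ∃ J : Finset (Fin n), J.card ≤ Nat.log 2 n ∧ ∀ u v : Fin n → Bool, (∀ i ∈ J, u i = v i) → y g u = y g v) →
        (#{u : Fin n → Bool | ringWinU c y u = true} : ℝ) ≤ θ₀ * 2 ^ n) :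
    ∃ θ₁ : ℝ, θ₁ < 1 ∧ ∃ n₀ : ℕ, ∀ n ≥ n₀, ∀ (c : ℕ) (b : Fin n → ZMod p)
    (Y : ZMod p → Fin (n + 1) → (Fin n → Bool) → Bool), (∀ s g, ∃ J : Finset (Fin n), J.card ≤ Nat.log 2 n ∧ ∀ u v : Fin n → Bool, (∀ i ∈ J, u i = v i) → Y s g u = Y s g v) →
      (#{u : Fin n → Bool | ringWinU c (formStrat p b Y) u = true} : ℝ) ≤ θ₁ * 2 ^ n := by
  obtain ⟨θ₁, hθ₁, n₁, hn₁⟩ := form_sparse_junta_hard p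
  obtain ⟨n₂, hn₂⟩ := form_reduction p (fun {n} _ y => ∀ g, ∃ J : Finset (Fin n), J.card ≤ Nat.log 2 n ∧ ∀ u v : Fin n → Bool, (∀ i ∈ J, u i = v i) → y g u = y g v) h1
    (formJunta_small p hp) hθ₀
  refine ⟨max θ₁ (θ₀ + (1 - θ₀) / 2), max_lt hθ₁ (by linarith), max n₁ n₂, fun n hn c b Y hY => ?_⟩
  have h2n : (0 : ℝ) ≤ 2 ^ n := by positivity
  by_cases hsp : 2 * (univ.filter fun i : Fin n => b i ≠ 0).card ≤ n
  · exact le_trans (hn₁ n (le_trans (le_max_left _ _) hn) c b Y hY hsp)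
      (mul_le_mul_of_nonneg_right (le_max_left _ _) h2n)
  · push Not at hsp
    exact le_trans (hn₂ n (le_trans (le_max_right _ _) hn) c b Y hsp.le hY)
      (mul_le_mul_of_nonneg_right (le_max_right _ _) h2n)

/-- **`log₂ n`-junta ⊕ ONE-SPARSE-LINE form strategies lose** (every prime `p ≥ 5`, any fixed `r`): the `(r+1)`-form
dial of `log₂ n`-junta class strategies over `A₀, …, A_r` with every combination off the line of `A₀` dense. -/
theorem formLine_hard (hp : 5 ≤ p) {θ₀ : ℝ} (hθ₀ : θ₀ < 1)
    (h1 : ∃ n₀ : ℕ, ∀ n ≥ n₀, ∀ (c : ℕ) (y : Fin (n + 1) → (Fin n → Bool) → Bool),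
      (∀ g, ∃ J : Finset (Fin n), J.card ≤ Nat.log 2 n ∧ ∀ u v : Fin n → Bool, (∀ i ∈ J, u i = v i) → y g u = y g v) →
        (#{u : Fin n → Bool | ringWinU c y u = true} : ℝ) ≤ θ₀ * 2 ^ n) (r : ℕ) :
    ∃ θ : ℝ, θ < 1 ∧ ∃ n₂ : ℕ, ∀ n ≥ n₂,
    ∀ (c : ℕ) (A : Fin (r + 1) → Fin n → ZMod p) (Y : (Fin (r + 1) → ZMod p) → Fin (n + 1) → (Fin n → Bool) → Bool),
      (∀ (σ : ZMod p) (τ : Fin r → ZMod p), τ ≠ 0 →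
        n ≤ 2 * (univ.filter fun i : Fin n => comb p (consV p σ τ) A i ≠ 0).card) →
        (∀ s g, ∃ J : Finset (Fin n), J.card ≤ Nat.log 2 n ∧ ∀ u v : Fin n → Bool, (∀ i ∈ J, u i = v i) → Y s g u = Y s g v) →
        (#{u : Fin n → Bool | ringWinU c (formStratR p A Y) u = true} : ℝ) ≤ θ * 2 ^ n := by
  obtain ⟨θ₁, hθ₁, h1'⟩ := formDialAny_hard p hp hθ₀ h1
  exact ⟨θ₁ + (1 - θ₁) / 2, by linarith,
    form_reductionLine p (fun {n} _ y => ∀ g, ∃ J : Finset (Fin n), J.card ≤ Nat.log 2 n ∧ ∀ u v : Fin n → Bool, (∀ i ∈ J, u i = v i) → y g u = y g v) h1' (formJunta_small p hp) hθ₁ r⟩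

end FormLine

end Summit.QuantumAdvantage.AdviceFreeQNC0.WindowCounter

/-! ## §K WELL-SPREAD RANK-`r` JUNTA ⊕ LINEAR-FORM DATA LOSE (every prime `p ≥ 5`, every fixed `r`)

`JLinData` level: if the NON-BLIND cuts' forms of `D` all lie in the span of `r` directions `A₀,…,A_{r-1}` every nonzero
combination of which is DENSE (`2·#supp(Σ_j t_j A_j) ≥ n` for all `t ≠ 0` — a WELL-SPREAD pencil), then the strategy is
the `r`-form dial of `log₂ n`-junta class strategies (`strat_eq_formStratR`: re-present `h_g(u,s) ↦ h_g(u, Σ_j l_{g,j} s_j)`)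
and `formJuntaR_hard` applies: `spreadRank_hard`.  `r = 1`, `A₀ = a` dense is the dense half of the rank-one aside;
the first piece of SliceDial's residual R2′ (semantic rank ≥ 2) that the block-product engine decides. -/

namespace Summit.QuantumAdvantage.AdviceFreeQNC0.JLinPeel

open Summit.QuantumAdvantage.AdviceFreeQNC0 JLinData

variable {p : ℕ} {n : ℕ}

/-- **re-presenting a rank-`r` pencil through the tables**: if every non-blind cut's form is `Σ_j l_{g,j} A_j`, the
strategy IS the `r`-form dial over `A` of the junta tables `Y_s(g,u) = h_g(u, Σ_j l_{g,j} s_j)` (a blind cut ignores the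
form value; take `l_g = 0`). -/
theorem strat_eq_formStratR [Fact p.Prime] (D : JLinData p n) {r : ℕ} (A : Fin r → Fin n → ZMod p)
    (hA : ∀ g, ¬ (∀ u s s', D.h g u s = D.h g u s') → ∃ l : Fin r → ZMod p, D.a g = fun i => ∑ j, l j * A j i) :
    ∃ Y : (Fin r → ZMod p) → Fin (n + 1) → (Fin n → Bool) → Bool,
      (∀ s g (u v : Fin n → Bool), (∀ i ∈ D.J g, u i = v i) → Y s g u = Y s g v) ∧
      D.strat = WindowCounter.formStratR p A Y := by
  classical
  have hl : ∀ g, ∃ l : Fin r → ZMod p, ¬ (∀ u s s', D.h g u s = D.h g u s') →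
      D.a g = fun i => ∑ j, l j * A j i := fun g => by
    by_cases hb : ∀ u s s', D.h g u s = D.h g u s'
    · exact ⟨0, fun h => (h hb).elim⟩
    · obtain ⟨l, hl⟩ := hA g hb
      exact ⟨l, fun _ => hl⟩
  choose l hl using hl
  refine ⟨fun s g u => D.h g u (∑ j, l g j * s j), fun s g u v huv => D.hJ g u v huv _, ?_⟩
  funext g u
  show D.h g u (D.form g u) = D.h g u (∑ j, l g j * WindowCounter.linF p (A j) u)
  by_cases hb : ∀ u s s', D.h g u s = D.h g u s'
  · exact hb u _ _
  · rw [← WindowCounter.linF_comb]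
    congr 1
    simp only [JLinData.form, hl g hb, WindowCounter.linF, WindowCounter.comb]

/-- **WELL-SPREAD RANK-`r` JUNTA ⊕ LINEAR-FORM DATA LOSE** (every prime `p ≥ 5`, every fixed `r`; rate `(1+θ₀)/2`):
`log₂ n`-juntas at arbitrary positions, the non-blind cuts' forms spanned by `r` directions all of whose nonzero
combinations have support `≥ n/2`. -/
theorem spreadRank_hard (p : ℕ) [Fact p.Prime] (hp : 5 ≤ p) (r : ℕ) :
    ∃ θ : ℝ, θ < 1 ∧ ∃ n₀ : ℕ, ∀ n ≥ n₀, ∀ (c : ℕ) (D : JLinData p n), (∀ g, (D.J g).card ≤ Nat.log 2 n) →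
      (∃ A : Fin r → Fin n → ZMod p,
        (∀ t : Fin r → ZMod p, t ≠ 0 → n ≤ 2 * (univ.filter fun i : Fin n => (∑ j, t j * A j i) ≠ 0).card) ∧
        ∀ g, ¬ (∀ u s s', D.h g u s = D.h g u s') → ∃ l : Fin r → ZMod p, D.a g = fun i => ∑ j, l j * A j i) →
      (winCount c D.strat : ℝ) ≤ θ * (2 : ℝ) ^ n := by
  obtain ⟨θ₀, hθ₀, h1⟩ := logJunta_hard p (by omega)
  obtain ⟨n₂, h⟩ := WindowCounter.formJuntaR_hard p hp hθ₀ h1 r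
  refine ⟨θ₀ + (1 - θ₀) / 2, by linarith, n₂, fun n hn c D hJ hP => ?_⟩
  obtain ⟨A, hsp, hA⟩ := hP
  obtain ⟨Y, hY, hstrat⟩ := strat_eq_formStratR D A hA
  rw [hstrat]
  exact h n hn c A Y hsp fun s g => ⟨D.J g, hJ g, fun u v huv => hY s g u v huv⟩

end Summit.QuantumAdvantage.AdviceFreeQNC0.JLinPeel

namespace Summit.QuantumAdvantage.AdviceFreeQNC0.JLinPeel

open Summit.QuantumAdvantage.AdviceFreeQNC0 JLinData

variable {p : ℕ} {n : ℕ}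

/-- **WELL-SPREAD RANK-`r` DATA WITH POLYLOG JUNTAS LOSE — ONE RATE FOR ALL `r`, `C`** (every prime `p ≥ 5`): `(log₂ n)^C`-juntas,
non-blind forms spanned by `r` well-spread directions.  (`C = 1` is `spreadRank_hard`; the budget slack is what subcube slicing
costs in the rank ladder.) -/
theorem spreadRank_hard_pow (p : ℕ) [Fact p.Prime] (hp : 5 ≤ p) :
    ∃ θ : ℝ, θ < 1 ∧ ∀ r C : ℕ, ∃ n₀ : ℕ, ∀ n ≥ n₀, ∀ (c : ℕ) (D : JLinData p n), (∀ g, (D.J g).card ≤ Nat.log 2 n ^ C) →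
      (∃ A : Fin r → Fin n → ZMod p,
        (∀ t : Fin r → ZMod p, t ≠ 0 → n ≤ 2 * (univ.filter fun i : Fin n => (∑ j, t j * A j i) ≠ 0).card) ∧
        ∀ g, ¬ (∀ u s s', D.h g u s = D.h g u s') → ∃ l : Fin r → ZMod p, D.a g = fun i => ∑ j, l j * A j i) →
      (winCount c D.strat : ℝ) ≤ θ * (2 : ℝ) ^ n := by
  obtain ⟨θ₀, hθ₀, H⟩ := walkHardFJuntaCuts p (by omega)
  refine ⟨θ₀ + (1 - θ₀) / 2, by linarith, fun r C => ?_⟩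
  obtain ⟨n₀, hn₀⟩ := H C
  obtain ⟨n₂, h⟩ := WindowCounter.formJuntaR_hard_pow p hp hθ₀ C ⟨n₀, hn₀⟩ r
  refine ⟨n₂, fun n hn c D hJ hP => ?_⟩
  obtain ⟨A, hsp, hA⟩ := hP
  obtain ⟨Y, hY, hstrat⟩ := strat_eq_formStratR D A hA
  rw [hstrat]
  exact h n hn c A Y hsp fun s g => ⟨D.J g, hJ g, fun u v huv => hY s g u v huv⟩

end Summit.QuantumAdvantage.AdviceFreeQNC0.JLinPeel

/-! ## §K″ (rev 10) ONE SPARSE LINE at the data level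

`JLinData` whose non-blind forms lie in the span of `A₀, A₁, …, A_r` with `A₀` ARBITRARY and every combination
`σA₀ + Σ_j τ_j A_{j+1}`, `τ ≠ 0`, dense lose (`WindowCounter.formLine_hard` + `strat_eq_formStratR`): strictly more than the
well-spread class of `spreadRank_hard` (there `A₀` must be dense too).  E.g. «`log₂ n` own bits ⊕ `wt(u) mod p` ⊕ one sparse
form `⟨b,u⟩ mod p`» for all cuts at once. -/

namespace Summit.QuantumAdvantage.AdviceFreeQNC0.JLinPeel

open Summit.QuantumAdvantage.AdviceFreeQNC0 JLinData

variable {p : ℕ} {n : ℕ}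

/-- **rank-`≤ r+1` junta ⊕ form data spread off ONE (arbitrary) line lose** (every prime `p ≥ 5`, every `r`). -/
theorem lineSpread_hard (p : ℕ) [Fact p.Prime] (hp : 5 ≤ p) (r : ℕ) :
    ∃ θ : ℝ, θ < 1 ∧ ∃ n₀ : ℕ, ∀ n ≥ n₀, ∀ (c : ℕ) (D : JLinData p n), (∀ g, (D.J g).card ≤ Nat.log 2 n) →
      (∃ A : Fin (r + 1) → Fin n → ZMod p,
        (∀ (σ : ZMod p) (τ : Fin r → ZMod p), τ ≠ 0 →
          n ≤ 2 * (univ.filter fun i : Fin n => (σ * A 0 i + ∑ j, τ j * A j.succ i) ≠ 0).card) ∧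
        ∀ g, ¬ (∀ u s s', D.h g u s = D.h g u s') → ∃ l : Fin (r + 1) → ZMod p, D.a g = fun i => ∑ j, l j * A j i) →
      (winCount c D.strat : ℝ) ≤ θ * (2 : ℝ) ^ n := by
  obtain ⟨θ₀, hθ₀, h1⟩ := logJunta_hard p (by omega)
  obtain ⟨θ, hθ, n₂, h⟩ := WindowCounter.formLine_hard p hp hθ₀ h1 r
  refine ⟨θ, hθ, n₂, fun n hn c D hJ hP => ?_⟩
  obtain ⟨A, hsp, hA⟩ := hP
  obtain ⟨Y, hY, hstrat⟩ := strat_eq_formStratR D A hA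
  rw [hstrat]
  exact h n hn c A Y (fun σ τ hτ => by simpa only [WindowCounter.comb_consV] using hsp σ τ hτ)
    fun s g => ⟨D.J g, hJ g, fun u v huv => hY s g u v huv⟩

end Summit.QuantumAdvantage.AdviceFreeQNC0.JLinPeel

namespace Summit.QuantumAdvantage.AdviceFreeQNC0.WindowCounter

open Summit.QuantumAdvantage.AdviceFreeQNC0 AffBells22 Literature.Computability.MetaComplexity
  Literature.Computability.MetaComplexity.Smolensky

/-! ## §M (rev 12) `W`-DETERMINED DIALS of junta tables lose when `2·|W| ≤ n` (generic slicing; no primality)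

The common generalisation of `form_sparse_junta_hard`: a strategy `u ↦ Y (F u) g u` whose SELECTOR `F` (any type of
values) depends only on the bits in a set `W` with `2|W| ≤ n`, over `log₂ n`-junta tables, loses with the rate of the tree's
`walkHardAllSubcube` (δ₀ = 1/2): on each subcube `{u_W = b_W}` the selector is constant and the strategy is a junta of the
free bits; fibre counting (`JLinPeel.sum_card_subcube`) sums the subcubes. -/

section DialSparse

variable {n : ℕ}

/-- CharDialSpreadRank helper `dial_sparse_junta_hard` (decomp-qadv land package; see the module docstring). -/
theorem dial_sparse_junta_hard : ∃ θ₁ : ℝ, θ₁ < 1 ∧ ∃ n₀ : ℕ, ∀ n ≥ n₀, ∀ (c : ℕ) (W : Finset (Fin n)) (S : Type)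
    (F : (Fin n → Bool) → S) (Y : S → Fin (n + 1) → (Fin n → Bool) → Bool),
    (∀ s g, ∃ J : Finset (Fin n), J.card ≤ Nat.log 2 n ∧ ∀ u v : Fin n → Bool, (∀ i ∈ J, u i = v i) →
      Y s g u = Y s g v) →
    (∀ u v : Fin n → Bool, (∀ i ∈ W, u i = v i) → F u = F v) → 2 * W.card ≤ n →
      (#{u : Fin n → Bool | ringWinU c (fun g u => Y (F u) g u) u = true} : ℝ) ≤ θ₁ * 2 ^ n := by
  obtain ⟨θ, hθ, H⟩ := walkHardAllSubcube (δ₀ := 1 / 2) (by norm_num)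
  refine ⟨θ, hθ, ?_⟩
  obtain ⟨n₀, hn₀⟩ := H 1
  refine ⟨n₀, fun n hn c W S F Y hY hF hsp => ?_⟩
  have hWcard : (W.card : ℝ) ≤ 1 / 2 * n := by
    have h' : ((2 * W.card : ℕ) : ℝ) ≤ n := by exact_mod_cast hsp
    push_cast at h'; linarith
  have hFm : ∀ b u : Fin n → Bool, F (subcubeMerge W b u) = F (subcubeMerge W b fun _ => false) :=
    fun b u => hF _ _ fun i hi => by simp [subcubeMerge, hi]
  have hcube : ∀ b : Fin n → Bool,
      ((univ.filter fun u : Fin n → Bool =>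
          ringWinU c (fun g u => Y (F u) g u) (subcubeMerge W b u) = true).card : ℝ) ≤ θ * 2 ^ n := by
    intro b
    refine hn₀ n hn c W b hWcard (fun g u => Y (F u) g u) fun g => ?_
    have e : (fun u => (fun g u => Y (F u) g u) g (subcubeMerge W b u)) =
        fun u => Y (F (subcubeMerge W b fun _ => false)) g (subcubeMerge W b u) := by
      funext u
      show Y (F (subcubeMerge W b u)) g (subcubeMerge W b u) = _
      rw [hFm b u]
    rw [e]
    obtain ⟨J, hJ, hdep⟩ := hY (F (subcubeMerge W b fun _ => false)) g
    exact BlockFibre37.hasDeg_of_dependsOn J (by rw [pow_one]; exact hJ) fun u v huv => hdep _ _ fun i hi => by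
      by_cases hiW : i ∈ W
      · simp [subcubeMerge, hiW]
      · simp [subcubeMerge, hiW, huv i hi]
  have hsum := JLinPeel.sum_card_subcube W (fun v : Fin n → Bool => ringWinU c (fun g u => Y (F u) g u) v = true)
  have hsumR : ((2 ^ n * #{u : Fin n → Bool | ringWinU c (fun g u => Y (F u) g u) u = true} : ℕ) : ℝ) =
      ∑ b : Fin n → Bool,
        ((univ.filter fun u : Fin n → Bool =>
          ringWinU c (fun g u => Y (F u) g u) (subcubeMerge W b u) = true).card : ℝ) := by
    rw [← hsum]; push_cast; rfl
  have hle : ∑ b : Fin n → Bool,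
      ((univ.filter fun u : Fin n → Bool =>
          ringWinU c (fun g u => Y (F u) g u) (subcubeMerge W b u) = true).card : ℝ) ≤
        ∑ _b : Fin n → Bool, θ * 2 ^ n := sum_le_sum fun b _ => hcube b
  rw [sum_const, card_univ, Fintype.card_fun, Fintype.card_bool, Fintype.card_fin, nsmul_eq_mul, ← hsumR] at hle
  push_cast at hle
  have h2n : (0 : ℝ) < 2 ^ n := by positivity
  nlinarith

end DialSparse

end Summit.QuantumAdvantage.AdviceFreeQNC0.WindowCounter

/-! ## §K‴ (rev 12) TWO SPARSE FORMS WITH A SMALL UNION OF SUPPORTS LOSE (the node's `twoSparseHard_iff_cover`, small side)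

Junta ⊕ form data whose non-blind cuts' forms lie in the span of two vectors `b₀, b₁` whose supports together touch at
most `n/2` coordinates lose (no primality; slicing on the union via `WindowCounter.dial_sparse_junta_hard` with the
selector `u ↦ u|_W` and the tables `v ↦ (g, u) ↦ h_g(u, form_g v)`).  So the residual of the node's `L_2` is two sparse
forms whose supports COVER more than half of the coordinates. -/

namespace Summit.QuantumAdvantage.AdviceFreeQNC0.JLinPeel

open Summit.QuantumAdvantage.AdviceFreeQNC0 JLinData AffBells22

/-- CharDialSpreadRank helper `twoSparse_smallUnion_hard` (decomp-qadv land package; see the module docstring). -/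
theorem twoSparse_smallUnion_hard (p : ℕ) : ∃ θ₁ : ℝ, θ₁ < 1 ∧ ∃ n₀ : ℕ, ∀ n ≥ n₀, ∀ (c : ℕ) (D : JLinData p n),
    (∀ g, (D.J g).card ≤ Nat.log 2 n) → ∀ b₀ b₁ : Fin n → ZMod p,
      2 * (univ.filter fun i : Fin n => b₀ i ≠ 0 ∨ b₁ i ≠ 0).card ≤ n →
      (∀ g, (¬ ∀ u s s', D.h g u s = D.h g u s') → ∃ μ ν : ZMod p, D.a g = fun i => μ * b₀ i + ν * b₁ i) →
        (winCount c D.strat : ℝ) ≤ θ₁ * (2 : ℝ) ^ n := by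
  obtain ⟨θ₁, hθ₁, n₁, h₁⟩ := WindowCounter.dial_sparse_junta_hard
  refine ⟨θ₁, hθ₁, n₁, fun n hn c D hJ b₀ b₁ hsp hpres => ?_⟩
  set W : Finset (Fin n) := univ.filter fun i : Fin n => b₀ i ≠ 0 ∨ b₁ i ≠ 0 with hWdef
  have hW0 : ∀ g, (¬ ∀ u s s', D.h g u s = D.h g u s') → ∀ i, i ∉ W → D.a g i = 0 := by
    intro g hg i hi
    obtain ⟨μ, ν, hμ⟩ := hpres g hg
    have h0 : ¬ (b₀ i ≠ 0 ∨ b₁ i ≠ 0) := fun h' => hi (mem_filter.2 ⟨mem_univ _, h'⟩)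
    push Not at h0
    rw [hμ]; simp [h0.1, h0.2]
  let F : (Fin n → Bool) → (Fin n → Bool) := fun u => subcubeMerge W u fun _ => false
  let Y : (Fin n → Bool) → Fin (n + 1) → (Fin n → Bool) → Bool := fun v g u => D.h g u (D.form g v)
  have hY : ∀ s g, ∃ J : Finset (Fin n), J.card ≤ Nat.log 2 n ∧ ∀ u v : Fin n → Bool, (∀ i ∈ J, u i = v i) →
      Y s g u = Y s g v := fun s g => ⟨D.J g, hJ g, fun u v huv => D.hJ g u v huv _⟩
  have hF : ∀ u v : Fin n → Bool, (∀ i ∈ W, u i = v i) → F u = F v := fun u v huv => by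
    funext i
    by_cases hi : i ∈ W
    · simp [F, subcubeMerge, hi, huv i hi]
    · simp [F, subcubeMerge, hi]
  have e : (fun g u => Y (F u) g u) = D.strat := by
    funext g u
    show D.h g u (D.form g (F u)) = D.h g u (D.form g u)
    by_cases hg : ∀ u s s', D.h g u s = D.h g u s'
    · exact hg u _ _
    · congr 1
      unfold JLinData.form
      refine sum_congr rfl fun i _ => ?_
      by_cases hi : i ∈ W
      · simp [F, subcubeMerge, hi]
      · simp [F, subcubeMerge, hi, hW0 g hg i hi]
  have hb := h₁ n hn c W (Fin n → Bool) F Y hY hF hsp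
  rw [e] at hb
  unfold winCount; exact hb

end Summit.QuantumAdvantage.AdviceFreeQNC0.JLinPeel
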